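import Mathlib
import Summits.Ventures.PercRepro2.Tail2DBlockCalc
import Summits.Ventures.PercRepro2.Tail2DHarrisSP
import Summits.Ventures.PercRepro2.Tail2DFlowOneBlocks
import Summits.Ventures.PercRepro2.Tail2DFlowOneStep01
import Summits.Ventures.PercRepro2.Tail2DParFin
import Summits.Ventures.PercRepro2.Tail2DParFinFlip
import Summits.Ventures.PercRepro2.Tail2DParFinTop
import Summits.Ventures.PercRepro2.Tail2DParFinDiag
import Summits.Ventures.PercRepro2.Tail2DParFinCount
import Summits.Ventures.PercRepro2.Tail2DParFinRelax
import Summits.Ventures.PercRepro2.Tail2DParFinSubTop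
import Summits.Ventures.PercRepro2.Tail2DParFinSubTopB
import Summits.Ventures.PercRepro2.Tail2DParFinFibres
import Summits.Ventures.PercRepro2.Tail2DOneChange
import Summits.Ventures.PercRepro2.Tail2DOneChangeB
import Summits.Ventures.PercRepro2.Tail2DOneChangeC
import Summits.Ventures.PercRepro2.Tail2DFourIdent

/-!
# (SD) at `(4,1)` on `8` identical flow-one factors — an explicit one-change table
(seat mine-b, cell pub-perc-repro2; conjectures/MINE-B.md §44)

The rates are `P(c/a)/D(c/a)` with `P` of non-negative coefficients (found by an LP on the coefficients, verified
exactly; mining/mine-b/code/g42/k67_tables.json, k78_tables.json), applied through the generic theorem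
`sdomZ_of_oneChange`; the per-type identities are in the companion files `Tail2DEig41IdentS*`, `Tail2DEig41IdentT*`, `Tail2DEig41IdentZ`.
-/

namespace Summit.Ventures.PercRepro2.Tail2D

open V2Closure Finset

namespace IdentEig41

/-- `D = 210 * a ^ 3 + 728 * a ^ 2 * c + 980 * a * c ^ 2 + 560 * c ^ 3` at `(4,1)` on `8` identical factors -/
noncomputable def dN (Y : V2Closure.SP) : ℚ := 210 * aY Y ^ 3 + 728 * aY Y ^ 2 * cY Y + 980 * aY Y * cY Y ^ 2 + 560 * cY Y ^ 3

/-- the identity rate by the type `(#R, #B)` -/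
noncomputable def ιN (Y : V2Closure.SP) (r b : ℕ) : ℚ :=
  if r = 4 ∧ b = 2 then (78 * aY Y ^ 3 + 196 * aY Y * cY Y ^ 2 + 56 * cY Y ^ 3) / dN Y else
  if r = 5 ∧ b = 2 then (92 * aY Y ^ 3 + (568 / 3 : ℚ) * aY Y ^ 2 * cY Y + (784 / 3 : ℚ) * aY Y * cY Y ^ 2 + (280 / 3 : ℚ) * cY Y ^ 3) / dN Y else
  if r = 6 ∧ b = 2 then (102 * aY Y ^ 3 + 296 * aY Y ^ 2 * cY Y + 308 * aY Y * cY Y ^ 2 + 120 * cY Y ^ 3) / dN Y else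
  if r = 4 ∧ b = 3 then ((354 / 5 : ℚ) * aY Y ^ 3 + (904 / 5 : ℚ) * aY Y ^ 2 * cY Y + 376 * aY Y * cY Y ^ 2) / dN Y else
  if r = 5 ∧ b = 3 then (108 * aY Y ^ 3 + 288 * aY Y ^ 2 * cY Y + 468 * aY Y * cY Y ^ 2 + 60 * cY Y ^ 3) / dN Y else
  if r = 4 ∧ b = 4 then ((402 / 5 : ℚ) * aY Y ^ 3 + (1168 / 5 : ℚ) * aY Y ^ 2 * cY Y + (892 / 5 : ℚ) * aY Y * cY Y ^ 2 + 280 * cY Y ^ 3) / dN Y else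
  0

/-- the flip rate per red by the type -/
noncomputable def fN (Y : V2Closure.SP) (r b : ℕ) : ℚ :=
  if b = 1 then ((r : ℚ))⁻¹ else
  if r = 4 ∧ b = 2 then (14 * aY Y ^ 3 + (349 / 3 : ℚ) * aY Y ^ 2 * cY Y + (350 / 3 : ℚ) * aY Y * cY Y ^ 2 + (280 / 3 : ℚ) * cY Y ^ 3) / dN Y else
  if r = 5 ∧ b = 2 then ((118 / 5 : ℚ) * aY Y ^ 3 + (4 / 3 : ℚ) * aY Y ^ 2 * cY Y + (112 / 3 : ℚ) * aY Y * cY Y ^ 2 + (280 / 3 : ℚ) * cY Y ^ 3) / dN Y else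
  if r = 6 ∧ b = 2 then (18 * aY Y ^ 3 + 40 * aY Y * cY Y ^ 2 + (220 / 3 : ℚ) * cY Y ^ 3) / dN Y else
  if r = 4 ∧ b = 3 then ((33 / 10 : ℚ) * aY Y ^ 3 + (489 / 5 : ℚ) * aY Y ^ 2 * cY Y + (147 / 2 : ℚ) * aY Y * cY Y ^ 2 + 70 * cY Y ^ 3) / dN Y else
  if r = 5 ∧ b = 3 then ((338 / 5 : ℚ) * aY Y ^ 2 * cY Y + (12 / 5 : ℚ) * aY Y * cY Y ^ 2) / dN Y else
  if r = 4 ∧ b = 4 then ((48 / 5 : ℚ) * aY Y ^ 3 + 18 * aY Y ^ 2 * cY Y + (518 / 5 : ℚ) * aY Y * cY Y ^ 2 + 56 * cY Y ^ 3) / dN Y else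
  0

/-- the relax rate per red by the type -/
noncomputable def xN (Y : V2Closure.SP) (r b : ℕ) : ℚ :=
  if r = 4 ∧ b = 2 then (19 * aY Y ^ 3 + (140 / 3 : ℚ) * aY Y ^ 2 * cY Y + (98 / 3 : ℚ) * aY Y * cY Y ^ 2) / dN Y else
  if r = 5 ∧ b = 2 then ((532 / 5 : ℚ) * aY Y ^ 2 * cY Y) / dN Y else
  if r = 6 ∧ b = 2 then (72 * aY Y ^ 2 * cY Y) / dN Y else
  if r = 4 ∧ b = 3 then ((63 / 2 : ℚ) * aY Y ^ 3 + (15 / 2 : ℚ) * aY Y ^ 2 * cY Y + 70 * aY Y * cY Y ^ 2) / dN Y else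
  if r = 5 ∧ b = 3 then ((102 / 5 : ℚ) * aY Y ^ 3 + 100 * aY Y * cY Y ^ 2) / dN Y else
  if r = 4 ∧ b = 4 then ((114 / 5 : ℚ) * aY Y ^ 3 + (414 / 5 : ℚ) * aY Y ^ 2 * cY Y + 14 * aY Y * cY Y ^ 2) / dN Y else
  0

/-- the rate table -/
noncomputable def ratesN (Y : V2Closure.SP) : OCRates 8 where
  ι := fun w => ιN Y (nR 8 w) (nB 8 w)
  f := fun w _ => fN Y (nR 8 w) (nB 8 w)
  x := fun w _ => xN Y (nR 8 w) (nB 8 w)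

variable {Y : V2Closure.SP}

/-- `D > 0` -/
theorem dN_pos (hR : 0 < (rSet Y).card) : 0 < dN Y := by
  unfold dN aY cY
  have : (0 : ℚ) < (rSet Y).card := by exact_mod_cast hR
  positivity

/-- non-negativity of the rates -/
theorem ιN_nonneg (hR : 0 < (rSet Y).card) (r b : ℕ) : 0 ≤ ιN Y r b := by
  have := dN_pos hR
  have ha : (0 : ℚ) < aY Y := by unfold aY; exact_mod_cast hR
  have hc : (0 : ℚ) ≤ cY Y := by unfold cY; positivity
  unfold ιN
  positivity

/-- non-negativity of the rates -/
theorem ratesN_iota_nonneg (hR : 0 < (rSet Y).card) (w : Fin 8 → Ltr) : 0 ≤ (ratesN Y).ι w :=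
  ιN_nonneg hR _ _

/-- non-negativity of the rates -/
theorem fN_nonneg (hR : 0 < (rSet Y).card) (r b : ℕ) : 0 ≤ fN Y r b := by
  have := dN_pos hR
  have ha : (0 : ℚ) < aY Y := by unfold aY; exact_mod_cast hR
  have hc : (0 : ℚ) ≤ cY Y := by unfold cY; positivity
  unfold fN
  positivity

/-- non-negativity of the rates -/
theorem ratesN_f_nonneg (hR : 0 < (rSet Y).card) (w : Fin 8 → Ltr) (i : Fin 8) : 0 ≤ (ratesN Y).f w i :=
  fN_nonneg hR _ _

/-- non-negativity of the rates -/
theorem xN_nonneg (hR : 0 < (rSet Y).card) (r b : ℕ) : 0 ≤ xN Y r b := by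
  have := dN_pos hR
  have ha : (0 : ℚ) < aY Y := by unfold aY; exact_mod_cast hR
  have hc : (0 : ℚ) ≤ cY Y := by unfold cY; positivity
  unfold xN
  positivity

/-- non-negativity of the rates -/
theorem ratesN_x_nonneg (hR : 0 < (rSet Y).card) (w : Fin 8 → Ltr) (i : Fin 8) : 0 ≤ (ratesN Y).x w i :=
  xN_nonneg hR _ _

/-- `|E(4,1)|` -/
theorem tailCountN_src (hY : FlowOne Y) : (tailCount (parFin 8 (fun _ => Y)) 4 1 : ℚ) = aY Y ^ 5 * (162 * aY Y ^ 3 + 504 * aY Y ^ 2 * cY Y + 588 * aY Y * cY Y ^ 2 + 280 * cY Y ^ 3) := by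
  rw [tailCount_parFin_ident 8 Y hY 4 1]
  unfold aY cY
  simp only [Finset.sum_range_succ, Finset.sum_range_zero]
  norm_num [Nat.choose]
  ring

/-- `|E(3,2)|` -/
theorem tailCountN_tgt (hY : FlowOne Y) : (tailCount (parFin 8 (fun _ => Y)) 3 2 : ℚ) = aY Y ^ 5 * dN Y := by
  rw [tailCount_parFin_ident 8 Y hY 3 2]
  unfold dN aY cY
  simp only [Finset.sum_range_succ, Finset.sum_range_zero]
  norm_num [Nat.choose]
  ring

/-- `γ_i = c/a` -/
theorem gamN (i : Fin 8) : gam 8 (fun _ => Y) i = cY Y / aY Y := rfl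


/-- the target sums by the type of the word -/
theorem tgt_reduce (w0 : Fin 8 → Ltr) :
    (if ocCom 8 4 1 w0 then (ratesN Y).ι w0 else 0)
      + ∑ j ∈ blueSet 8 w0, ((ratesN Y).f (Function.update w0 j Ltr.R) j
          + (if ocCom 8 4 1 (Function.update w0 j Ltr.R) then (ratesN Y).x (Function.update w0 j Ltr.R) j else 0))
      + ∑ l ∈ cSet 8 w0, (ratesN Y).x (Function.update w0 l Ltr.R) l
    = (if (4 ≤ nR 8 w0 ∧ 1 ≤ nB 8 w0) ∧ 1 + 1 ≤ nB 8 w0 then ιN Y (nR 8 w0) (nB 8 w0) else 0)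
      + (nB 8 w0 : ℚ) * (fN Y (nR 8 w0 + 1) (nB 8 w0 - 1)
          + (if (4 ≤ nR 8 w0 + 1 ∧ 1 ≤ nB 8 w0 - 1) ∧ 1 + 1 ≤ nB 8 w0 - 1
            then xN Y (nR 8 w0 + 1) (nB 8 w0 - 1) else 0))
      + (nC 8 w0 : ℚ) * xN Y (nR 8 w0 + 1) (nB 8 w0) := by
  have hι : ∀ w', (ratesN Y).ι w' = ιN Y (nR 8 w') (nB 8 w') := fun _ => rfl
  have hf : ∀ w' i, (ratesN Y).f w' i = fN Y (nR 8 w') (nB 8 w') := fun _ _ => rfl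
  have hx : ∀ w' i, (ratesN Y).x w' i = xN Y (nR 8 w') (nB 8 w') := fun _ _ => rfl
  simp only [hι, hf, hx]
  have hsumB : ∑ j ∈ blueSet 8 w0, (fN Y (nR 8 (Function.update w0 j Ltr.R)) (nB 8 (Function.update w0 j Ltr.R))
      + (if ocCom 8 4 1 (Function.update w0 j Ltr.R)
          then xN Y (nR 8 (Function.update w0 j Ltr.R)) (nB 8 (Function.update w0 j Ltr.R)) else 0))
      = (nB 8 w0 : ℚ) * (fN Y (nR 8 w0 + 1) (nB 8 w0 - 1)
          + (if (4 ≤ nR 8 w0 + 1 ∧ 1 ≤ nB 8 w0 - 1) ∧ 1 + 1 ≤ nB 8 w0 - 1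
            then xN Y (nR 8 w0 + 1) (nB 8 w0 - 1) else 0)) := by
    rw [nB_eq_card_blueSet, ← nsmul_eq_mul, ← Finset.sum_const]
    apply Finset.sum_congr rfl
    intro j hj
    have hjB : w0 j = Ltr.B := by simpa [blueSet] using hj
    have e1 := nR_update_R 8 w0 j (by rw [hjB]; exact Ltr.noConfusion)
    have e2 := nB_update_R_of_B 8 w0 j hjB
    have e2' : nB 8 (Function.update w0 j Ltr.R) = nB 8 w0 - 1 := by omega
    have hcom : ocCom 8 4 1 (Function.update w0 j Ltr.R)
        ↔ (4 ≤ nR 8 (Function.update w0 j Ltr.R) ∧ 1 ≤ nB 8 (Function.update w0 j Ltr.R))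
          ∧ 1 + 1 ≤ nB 8 (Function.update w0 j Ltr.R) := Iff.rfl
    simp only [hcom, e1, e2']
    rw [nB_eq_card_blueSet]
  have hsumC : ∑ l ∈ cSet 8 w0, xN Y (nR 8 (Function.update w0 l Ltr.R)) (nB 8 (Function.update w0 l Ltr.R))
      = (nC 8 w0 : ℚ) * xN Y (nR 8 w0 + 1) (nB 8 w0) := by
    show _ = ((cSet 8 w0).card : ℚ) * _
    rw [← nsmul_eq_mul, ← Finset.sum_const]
    apply Finset.sum_congr rfl
    intro l hl
    have hlC : w0 l = Ltr.C := by simpa [cSet] using hl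
    have e1 := nR_update_R 8 w0 l (by rw [hlC]; exact Ltr.noConfusion)
    have e2 := nB_update_R_of_ne 8 w0 l (by rw [hlC]; exact Ltr.noConfusion)
    rw [e1, e2]
  rw [hsumB, hsumC]


end IdentEig41

end Summit.Ventures.PercRepro2.Tail2D
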